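import Summits.ResolutionOfSingularities.ResolutionOfSingularities.Theorems.RisoStrataRtdAffineLine

/-!
# Crux `RtdLocal` (stmt-ResolutionOfSingularities-18840) — the hypothesis `s ∈ B` is load-bearing

Route `ResolutionOfSingularities/RisoStrata`, crux `RtdLocal` (Zariski-locality of the typed
riso-triviality dimension under `B ↦ B[s⁻¹]`).  `rtdLocal_false_without_mem` proves that the crux
with the single hypothesis `hs : s ∈ B` deleted (everything else verbatim) is FALSE.

Witness: `p = 2`, `k = 𝔽₂^alg`, `K = k(X)`, `B = ⊥ (= k)`, `s = X⁻¹`, `r = 1`, `m' =` the origin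
(`ker ev₀`) of `B' := k[↑⊥ ∪ {s⁻¹}] = k[X]`.
* LHS `Rtd B' m' 1` holds — the identity straightener of the affine line (one generator `X`,
  `W = k¹`, `φ a = a X`; the translate `a X + w` of an arc is again an arc because `k[X]` is free and
  every element of `m'` has zero constant term): the proved support item `RtdAffineLine`, redone for
  the subalgebra `k[↑⊥ ∪ {X⁻¹⁻¹}]` through `E : k[X] ≃ₐ[k] B'`.
* RHS `Rtd ⊥ m 1` fails for every proper ideal `m` of `⊥ = k`: the arc space of `k` is ONE point (a
  `k`-algebra map out of `k` is determined), so the translate by `w = t·u`, `u ∈ W ∖ 0`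
  (`finrank W ≥ 1`), is not realised by a second arc — clause (3) fails.
Moral for provers: `s ∈ B` is exactly what makes `B ⊆ B[s⁻¹]` a localisation with the same local
ring (and the same arcs) at `m'`; without it `B[s⁻¹]` acquires new transcendentals.
No definitions, no facts; kernel-only.  Imports the landed `RisoStrataRtdAffineLine` for the two
Hahn-series evaluation lemmas `rtdAffineLine_orderTop_aeval_nonneg/pos`.
-/

set_option linter.dupNamespace false

namespace Summit.ResolutionOfSingularities.ResolutionOfSingularities.Theorems

open Polynomial

section Helpers

variable {k : Type} [Field k]

variable {A' : Type} [Semiring A'] [Algebra k A'] (E : k[X] ≃ₐ[k] A')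

/-- Two `k`-algebra maps out of a copy `A' ≅ k[X]` of the polynomial ring that agree at the
variable are equal. [folklore] -/
theorem rtdLocalNeg_algHom_eq {A : Type} [Semiring A] [Algebra k A] {α β : A' →ₐ[k] A}
    (h : α (E X) = β (E X)) : α = β := by
  have hX : (α.comp (E : k[X] →ₐ[k] A')) X = (β.comp (E : k[X] →ₐ[k] A')) X := h
  have hcomp := Polynomial.algHom_ext hX
  ext x
  obtain ⟨f, rfl⟩ := E.surjective x
  exact DFunLike.congr_fun hcomp f

/-- A `k`-algebra map `ψ` out of `A' ≅ k[X]` sending the variable to a Hahn series of positive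
order sends (the image of) every polynomial without constant term to positive order. [folklore] -/
theorem rtdLocalNeg_orderTop_pos_of_coeff (ψ : A' →ₐ[k] HahnSeries ℚ k)
    (hψ : 0 < (ψ (E X)).orderTop) {f : k[X]} (hf : f.coeff 0 = 0) :
    0 < (ψ (E f)).orderTop := by
  have key : ψ (E f) = aeval (ψ (E X)) f := by
    change (ψ.comp (E : k[X] →ₐ[k] A')) f = aeval ((ψ.comp (E : k[X] →ₐ[k] A')) X) f
    rw [aeval_algHom_apply, aeval_X_left_apply]
  rw [key]
  exact rtdAffineLine_orderTop_aeval_pos hψ hf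

variable {K : Type} [Field K] [Algebra k K]

/-- `k`-algebra maps out of `⊥ = k ⊆ K` form a subsingleton (inside any subtype). [folklore] -/
theorem rtdLocalNeg_arc_bot_subsingleton {A : Type} [Semiring A] [Algebra k A]
    (P : (↥(⊥ : Subalgebra k K) →ₐ[k] A) → Prop) (a b : {α // P α}) : a = b := by
  refine Subtype.ext (AlgHom.ext fun x => ?_)
  obtain ⟨c, hc⟩ := Algebra.mem_bot.mp x.2
  have hx : x = algebraMap k _ c := Subtype.ext hc.symm
  rw [hx, AlgHom.commutes, AlgHom.commutes]

/-- Elements of a proper ideal of `⊥ = k ⊆ K` are zero, so any map sends them to order `⊤ > 0`.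
[folklore] -/
theorem rtdLocalNeg_orderTop_pos_of_mem_bot (α : ↥(⊥ : Subalgebra k K) →ₐ[k] HahnSeries ℚ k)
    (J : Ideal ↥(⊥ : Subalgebra k K)) (hJ : J ≠ ⊤) (x : ↥(⊥ : Subalgebra k K)) (hx : x ∈ J) :
    0 < (α x).orderTop := by
  obtain ⟨c, hc⟩ := Algebra.mem_bot.mp x.2
  have hxc : x = algebraMap k _ c := Subtype.ext hc.symm
  by_cases hc0 : c = 0
  · rw [hxc, hc0, map_zero, map_zero, HahnSeries.orderTop_zero]
    exact WithTop.top_pos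
  · exact absurd (J.eq_top_of_isUnit_mem hx (hxc ▸ (Ne.isUnit hc0).map _)) hJ

end Helpers

/-- **`s ∈ B` is load-bearing in `RtdLocal`**: the crux `RisoStrata.RtdLocal` with the hypothesis
`hs : s ∈ B` deleted (all other text verbatim) is false.
Witness `p = 2`, `k = 𝔽₂^alg`, `K = k(X)`, `B = ⊥`, `s = X⁻¹`, `m' =` origin of `k[X]`, `r = 1`.
[folklore] -/
theorem rtdLocal_false_without_mem : ¬ (∀ p : ℕ, p.Prime → ∀ (k : Type) [Field k] [CharP k p] [IsAlgClosed k] (K : Type) [Field K] [Algebra k K] (B : Subalgebra k K) (s : K), s ≠ 0 → B.FG → let Arc : ∀ (B : Subalgebra k K), Ideal ↥B → Type := fun B m => {α : ↥B →ₐ[k] HahnSeries ℚ k // ∀ b ∈ m, 0 < (α b).orderTop}; let Rtd : ∀ (B : Subalgebra k K), Ideal ↥B → ℕ → Prop := fun B m r => ∃ (n : ℕ) (g : Fin n → ↥B), (∀ i, g i ∈ m) ∧ Algebra.adjoin k (Set.range fun i => (g i : K)) = B ∧ ∃ W : Submodule k (Fin n → k), r ≤ Module.finrank k ↥W ∧ ∃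 φ : Arc B m → (Fin n → HahnSeries ℚ k), (∀ a b : Arc B m, a ≠ b → ∃ j, ∀ i, (a.1 (g j) - b.1 (g j)).orderTop < ((φ a i - φ b i) - (a.1 (g i) - b.1 (g i))).orderTop) ∧ (∀ a i, 0 < (φ a i).orderTop) ∧ (∀ a, ∀ w : Fin n → HahnSeries ℚ k, (∀ i, 0 < (w i).orderTop) → w ∈ Submodule.span (HahnSeries ℚ k) ((fun u : Fin n → k => fun i => HahnSeries.C (u i)) '' (W : Set (Fin n → k))) → ∃ b, φ b = φ a + w); ∀ (m' : Ideal ↥(Algebra.adjoin k ((B : Set K) ∪ {s⁻¹}))), m'.IsMaximal → ∀ r : ℕ, (Rtd (Algebra.adjoin k ((B : Set K) ∪ {s⁻¹})) m' r ↔ Rtd B (m'.comap (Subalgebra.inclusion (show B ≤ Algebra.adjoin k ((B : Set K) ∪ {s⁻¹}) from fun _ hb => Algebra.subset_adjoin (Set.mem_union_left _ hb)))) r)) := by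
  intro H
  obtain ⟨k, _i1, _i2, _i3, K, _i4, _i5, t, ht⟩ : ∃ (k : Type) (_ : Field k) (_ : CharP k 2)
      (_ : IsAlgClosed k) (K : Type) (_ : Field K) (_ : Algebra k K) (t : K), Transcendental k t :=
    ⟨AlgebraicClosure (ZMod 2), inferInstance, inferInstance, inferInstance,
      RatFunc (AlgebraicClosure (ZMod 2)), inferInstance, inferInstance, RatFunc.X,
      RatFunc.transcendental_X⟩
  have ht0 : t ≠ 0 := fun h => ht (h ▸ isAlgebraic_zero)
  have H' := H 2 Nat.prime_two k K ⊥ t⁻¹ (inv_ne_zero ht0) Subalgebra.fg_bot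
  clear H
  dsimp only at H'
  -- `B' := k[↑⊥ ∪ {t⁻¹⁻¹}] = k[t] ≅ k[X]`
  have e : Algebra.adjoin k ({t} : Set K) =
      Algebra.adjoin k (((⊥ : Subalgebra k K) : Set K) ∪ {t⁻¹⁻¹}) := by
    rw [inv_inv]
    apply le_antisymm
    · exact Algebra.adjoin_mono Set.subset_union_right
    · refine Algebra.adjoin_le ?_
      rintro z (hz | hz)
      · exact (bot_le : (⊥ : Subalgebra k K) ≤ Algebra.adjoin k {t}) hz
      · exact Algebra.subset_adjoin hz
  let E : k[X] ≃ₐ[k] ↥(Algebra.adjoin k (((⊥ : Subalgebra k K) : Set K) ∪ {t⁻¹⁻¹})) :=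
    (algEquivOfTranscendental k t ht).trans (Subalgebra.equivOfEq _ _ e)
  have hEX : ((E X : ↥(Algebra.adjoin k (((⊥ : Subalgebra k K) : Set K) ∪ {t⁻¹⁻¹}))) : K) = t := by
    change (((Subalgebra.equivOfEq _ _ e) (algEquivOfTranscendental k t ht X)) : K) = t
    rw [algEquivOfTranscendental_apply_X]
    rfl
  -- the origin `m' = ker ev₀`
  let ev₀ : ↥(Algebra.adjoin k (((⊥ : Subalgebra k K) : Set K) ∪ {t⁻¹⁻¹})) →ₐ[k] k :=
    (aeval (0 : k)).comp (E.symm : _ →ₐ[k] k[X])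
  have hev₀ : ∀ f : k[X], ev₀ (E f) = f.coeff 0 := by
    intro f
    change aeval (0 : k) (E.symm (E f)) = f.coeff 0
    rw [AlgEquiv.symm_apply_apply, coeff_zero_eq_aeval_zero]
  have hm' : (RingHom.ker ev₀).IsMaximal :=
    RingHom.ker_isMaximal_of_surjective ev₀ fun c => ⟨algebraMap k _ c, AlgHom.commutes ev₀ c⟩
  have htm' : E X ∈ RingHom.ker ev₀ := by
    rw [RingHom.mem_ker, ← coeff_X_zero (R := k)]
    exact hev₀ X
  have hpos : ∀ (ψ : ↥(Algebra.adjoin k (((⊥ : Subalgebra k K) : Set K) ∪ {t⁻¹⁻¹})) →ₐ[k]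
      HahnSeries ℚ k), 0 < (ψ (E X)).orderTop → ∀ b ∈ RingHom.ker ev₀, 0 < (ψ b).orderTop := by
    intro ψ hψ b hb
    obtain ⟨f, rfl⟩ := E.surjective b
    have hf : f.coeff 0 = 0 := by rw [← hev₀]; exact RingHom.mem_ker.mp hb
    exact rtdLocalNeg_orderTop_pos_of_coeff E ψ hψ hf
  -- LHS true ⇒ RHS true
  obtain ⟨n, g, -, -, W, hW, φ, -, -, h3⟩ := (H' (RingHom.ker ev₀) hm' 1).mp (by
    refine ⟨1, fun _ => E X, fun _ => htm', ?_, ⊤, ?_, fun a _ => a.1 (E X), ?_,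
      fun a _ => a.2 _ htm', ?_⟩
    · -- the single generator `t` generates `k[↑⊥ ∪ {t⁻¹⁻¹}] = k[t]`
      simp only [hEX, Set.range_const]
      exact e
    · -- `finrank k k¹ = 1`
      rw [finrank_top, Module.finrank_fin_fun]
    · -- rv-separation: distinct arcs differ at the variable, the straightened difference vanishes
      intro a b hab
      refine ⟨0, fun i => ?_⟩
      rw [sub_self, HahnSeries.orderTop_zero, WithTop.lt_top_iff_ne_top, Ne,
        HahnSeries.orderTop_eq_top, sub_eq_zero]
      exact fun h => hab (Subtype.ext (rtdLocalNeg_algHom_eq E h))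
    · -- translation by any `w` of positive order: the arc `X ↦ a X + w 0`
      intro a w hw _
      have hu : 0 < (a.1 (E X) + w 0).orderTop :=
        (lt_min (a.2 _ htm') (hw 0)).trans_le HahnSeries.min_orderTop_le_orderTop_add
      have hψt : ((aeval (a.1 (E X) + w 0)).comp (E.symm : _ →ₐ[k] k[X])) (E X) =
          a.1 (E X) + w 0 := by
        change aeval _ (E.symm (E X)) = _
        rw [AlgEquiv.symm_apply_apply, aeval_X]
      refine ⟨⟨(aeval (a.1 (E X) + w 0)).comp (E.symm : _ →ₐ[k] k[X]), fun b hb =>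
        hpos _ (hψt.symm ▸ hu) b hb⟩, ?_⟩
      funext i
      rw [Pi.add_apply, Subsingleton.elim i 0]
      exact hψt)
  -- RHS: `Rtd ⊥ m 1` is impossible — the arc space of `⊥ = k` is one point
  let α₀ : ↥(⊥ : Subalgebra k K) →ₐ[k] HahnSeries ℚ k :=
    (Algebra.ofId k (HahnSeries ℚ k)).comp (Algebra.botEquiv k K : _ →ₐ[k] k)
  obtain ⟨u, hu0⟩ :=
    Module.finrank_pos_iff_exists_ne_zero.mp (by omega : 0 < Module.finrank k ↥W)
  obtain ⟨b, hb⟩ := h3 ⟨α₀, rtdLocalNeg_orderTop_pos_of_mem_bot α₀ _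
      (Ideal.comap_ne_top _ hm'.ne_top)⟩
    (fun i => HahnSeries.single (1 : ℚ) ((u : Fin n → k) i))
    (fun i => by
      by_cases hi : (u : Fin n → k) i = 0
      · rw [hi, HahnSeries.single_eq_zero, HahnSeries.orderTop_zero]
        exact WithTop.top_pos
      · rw [HahnSeries.orderTop_single hi]
        exact_mod_cast one_pos)
    (by
      have hw : (fun i => HahnSeries.single (1 : ℚ) ((u : Fin n → k) i)) =
          HahnSeries.single (1 : ℚ) (1 : k) • fun i => HahnSeries.C ((u : Fin n → k) i) := by
        funext i
        rw [Pi.smul_apply, smul_eq_mul, HahnSeries.C_apply, HahnSeries.single_mul_single,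
          add_zero, one_mul]
      rw [hw]
      exact Submodule.smul_mem _ _ (Submodule.subset_span ⟨u, u.2, rfl⟩))
  rw [rtdLocalNeg_arc_bot_subsingleton _ b ⟨α₀, rtdLocalNeg_orderTop_pos_of_mem_bot α₀ _
      (Ideal.comap_ne_top _ hm'.ne_top)⟩] at hb
  have hw0 := left_eq_add.mp hb
  apply hu0
  rw [← Submodule.coe_eq_zero]
  funext i
  exact HahnSeries.single_eq_zero_iff.mp (congr_fun hw0 i)

end Summit.ResolutionOfSingularities.ResolutionOfSingularities.Theorems
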